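import Summits.ABC.ABC.Theses.RibetTakahashiSplit
import Literature.NumberTheory.EllipticCurves.SzpiroOfAbcProofs
import Literature.NumberTheory.EllipticCurves.SzpiroLocalDataProofs
import Literature.NumberTheory.DiophantineGeometry.ConductorFactorizationProofs

/-!
# Crux `RibetTakahashiSplit.ThinWeightedSzpiro` (stmt-ABC-17927): the squarefree-discriminant slice

Calibration FROM BELOW of the crux r3″ itself (not of a line's normal form), continuation lead
prover-line-stmt-ABC-17927-c1-0, line `Sketch`, 2026-08-17.

The crux says: `∃ θ > 0 ∀ ε > 0 ∀ K ∃ C`, for every global minimal `ℤ`-model `W₀` (elliptic, minimal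
at every place) semistable away from `2` that is `θ`-thin (`T ≤ K · N^θ`,
`T = ∏_{p ∣ N, p² ∤ N} ord_p Δ_min`), `max(|Δ|, |c₄|³) ≤ C · (N · T)^{6+ε}`.

**The slice.** An integer Weierstrass equation `W₀` with SQUAREFREE discriminant is automatically
elliptic, minimal at every prime (`p¹² ∤ Δ`), semistable at EVERY prime (`p² ∣ N ⇒ p^{f_p} ∣ Δ` with
`f_p ≥ 2`), has `N ∣ |Δ|`, and has weight `T = 1` (every factor `ord_p Δ_min = ord_p Δ = 1`). Hence it
lies in the `θ`-thin class for EVERY `θ > 0` already with `K = 1` (`1 ≤ N^θ`), and on it the crux's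
conclusion carries no weight: whatever class exponent a proof of the crux chooses, it proves

* `squarefreeSlice_of_thinWeightedSzpiro`: `∀ ε > 0 ∃ C ∀ W₀ : WeierstrassCurve ℤ`, `Squarefree |Δ(W₀)|`
  `→ max(|Δ|, |c₄|³) ≤ C · N^{6+ε}` — Bombieri–Gubler's generalized Szpiro conjecture 12.5.11
  verbatim on squarefree discriminants (no class condition, no weight), and
* `hallSquarefree_of_thinWeightedSzpiro`: `∀ ε > 0 ∃ C ∀ W₀ : WeierstrassCurve ℤ`, `Squarefree |Δ(W₀)|`
  `→ |c₄|³ ≤ C · |Δ|^{6+ε}` — Hall's conjecture at its sharp exponent (`|x| ≪ |k|^{2+ε}` for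
  `x³ − y² = 1728 k`, B–G 12.5.1 in exponent form; barrier `Literature.Barriers.ABC.HallExponentSharp`)
  on the Mordell curves `X³ − Y² = 1728 Δ`, `Δ` squarefree, at the points `(c₄, c₆)` of integer
  Weierstrass equations — a statement with no conductor, no minimality, no class and no weight in it.

Both consequences are open (in print only exponential bounds: Baker-type bounds for integral points on
Mordell curves; `h(E) ≪ N log N`, Murty–Pasten 2013, via modularity). So EVERY line for this crux, at
every class exponent, must contain a proof of Hall's conjecture on squarefree discriminants: the class
condition `T ≤ K · N^θ` — the only hypothesis that distinguishes r3″ from r3′ `WeightedSzpiroBound`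
(`↔ ABC`, landed `WeightedSzpiroBound.iff_abc`) — is VACUOUS on this slice, and the level-lowering /
congruence-module mechanism the route intends for r3″ (degree factor `∏_{q ∣ N⁻} v_q(Δ)`) has nothing
to act on there (`v_q(Δ) = 1` for every bad `q`).

Elementary inputs only (all PROVED in the tree): `isMinimalAt_baseChange_int_of_not_pow_dvd_Δ`,
`pow_conductorExponent_dvd_Δ`, `conductorNorm_dvd_of_forall_conductorExponent_le`,
`factorization_conductorNorm_holds`, `radical_conductorNorm_eq_holds`,
`minimalDiscriminantNorm_eq_natAbs_holds`, `conductorNorm_pos_holds` (Silverman AEC VII.1, VIII.8,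
VIII.11; B–G 12.5.9).
-/

-- `Summit.<Summit>.<Problem>` is the mandated summit-side namespace (CONVENTIONS §2); for the
-- single-conjunct summit `ABC` the two coincide, so the duplicate `ABC.ABC` is deliberate.
set_option linter.dupNamespace false

namespace Summit.ABC.ABC.Theorems.ThinWeightedSzpiro

open IsDedekindDomain WeierstrassCurve Rat.HeightOneSpectrum
open Literature.NumberTheory.EllipticCurves
open Summit.ABC.ABC.Theses.RibetTakahashiSplit

variable (W₀ : WeierstrassCurve ℤ)

/-! ## Integer equations with squarefree discriminant -/

/-- A squarefree discriminant is non-zero. -/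
theorem Δ_ne_zero_of_squarefree (hsq : Squarefree W₀.Δ.natAbs) : W₀.Δ ≠ 0 := by
  intro h0
  rw [h0, Int.natAbs_zero] at hsq
  exact not_squarefree_zero hsq

/-- An integer equation with squarefree discriminant is an elliptic curve over `ℚ`. -/
theorem isElliptic_of_squarefree (hsq : Squarefree W₀.Δ.natAbs) : (W₀.baseChange ℚ).IsElliptic :=
  isElliptic_baseChange_int W₀ (Δ_ne_zero_of_squarefree W₀ hsq)

/-- For a prime `p` and a squarefree `|Δ|`, `p² ∤ Δ` in `ℤ`. -/
theorem not_sq_dvd_Δ_of_squarefree (hsq : Squarefree W₀.Δ.natAbs) {p : ℕ} (hp : p.Prime) :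
    ¬ (p : ℤ) ^ 2 ∣ W₀.Δ := by
  intro h
  have h' : p * p ∣ W₀.Δ.natAbs := by
    rw [← pow_two, ← Int.natCast_dvd]
    exact_mod_cast h
  exact hp.not_isUnit (hsq p h')

/-- An integer equation with squarefree discriminant is minimal at every prime (`p¹² ∤ Δ`,
Silverman AEC VII.1 Remark 1.1). -/
theorem isMinimalAt_of_squarefree (hsq : Squarefree W₀.Δ.natAbs) (v : HeightOneSpectrum ℤ) :
    (W₀.baseChange ℚ).IsMinimalAt v := by
  refine isMinimalAt_baseChange_int_of_not_pow_dvd_Δ fun h ↦ ?_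
  refine not_sq_dvd_Δ_of_squarefree W₀ hsq (prime_natGenerator v) ?_
  exact dvd_trans (pow_dvd_pow _ (by norm_num)) h

/-- For a global minimal integer equation, `N ∣ |Δ|` (`f_p ≤ ord_p Δ_min = ord_p Δ`, B–G 12.5.9(d)). -/
theorem conductorNorm_dvd_natAbs_Δ [(W₀.baseChange ℚ).IsElliptic]
    (hmin : ∀ v : HeightOneSpectrum ℤ, (W₀.baseChange ℚ).IsMinimalAt v) :
    (W₀.baseChange ℚ).conductorNorm ℤ ∣ W₀.Δ.natAbs := by
  have hΔ0 : W₀.Δ ≠ 0 := W₀.Δ_ne_zero_of_isElliptic_baseChange_int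
  have hd0 : W₀.Δ.natAbs ≠ 0 := Int.natAbs_ne_zero.mpr hΔ0
  refine conductorNorm_dvd_of_forall_conductorExponent_le (W₀.baseChange ℚ) hd0 fun p ↦ ?_
  obtain ⟨q, hq⟩ := p
  have hv : natGenerator ((primesEquiv (R := ℤ)).symm ⟨q, hq⟩) = q :=
    Rat.natGenerator_primesEquiv_symm ⟨q, hq⟩
  have hdvd := pow_conductorExponent_dvd_Δ (W₀ := W₀) (hmin ((primesEquiv (R := ℤ)).symm ⟨q, hq⟩))
  rw [hv] at hdvd
  have hdvd' : q ^ (W₀.baseChange ℚ).conductorExponent ((primesEquiv (R := ℤ)).symm ⟨q, hq⟩) ∣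
      W₀.Δ.natAbs := by
    rw [← Int.natCast_dvd]
    exact_mod_cast hdvd
  exact (hq.pow_dvd_iff_le_factorization hd0).mp hdvd'

/-- An integer equation with squarefree discriminant is semistable at every prime: `p² ∤ N`. -/
theorem not_sq_dvd_conductorNorm_of_squarefree (hsq : Squarefree W₀.Δ.natAbs) {p : ℕ}
    (hp : p.Prime) : ¬ p ^ 2 ∣ (W₀.baseChange ℚ).conductorNorm ℤ := by
  haveI := isElliptic_of_squarefree W₀ hsq
  intro h
  have h' : p ^ 2 ∣ W₀.Δ.natAbs :=
    h.trans (conductorNorm_dvd_natAbs_Δ W₀ (isMinimalAt_of_squarefree W₀ hsq))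
  refine not_sq_dvd_Δ_of_squarefree W₀ hsq hp ?_
  rw [← Int.natCast_dvd] at h'
  exact_mod_cast h'

/-- On a squarefree discriminant the weight of the crux is `T = ∏_{p ∣ N, p² ∤ N} ord_p Δ_min = 1`:
every bad prime `p` has `ord_p Δ_min = ord_p Δ = 1`. -/
theorem weight_eq_one_of_squarefree (hsq : Squarefree W₀.Δ.natAbs) :
    (∏ p ∈ ((W₀.baseChange ℚ).conductorNorm ℤ).primeFactors with
        ¬ p ^ 2 ∣ (W₀.baseChange ℚ).conductorNorm ℤ,
      ((W₀.baseChange ℚ).minimalDiscriminantNorm ℤ).factorization p) = 1 := by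
  haveI := isElliptic_of_squarefree W₀ hsq
  have hΔ0 : W₀.Δ ≠ 0 := Δ_ne_zero_of_squarefree W₀ hsq
  have hmin := isMinimalAt_of_squarefree W₀ hsq
  have hDm : (W₀.baseChange ℚ).minimalDiscriminantNorm ℤ = W₀.Δ.natAbs :=
    minimalDiscriminantNorm_eq_natAbs_holds W₀ hΔ0 hmin
  -- `N` and `|Δ| = |Δ_min|` have the same prime factors
  have hrad : UniqueFactorizationMonoid.radical ((W₀.baseChange ℚ).conductorNorm ℤ) =
      UniqueFactorizationMonoid.radical W₀.Δ.natAbs := by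
    rw [← hDm]
    exact radical_conductorNorm_eq_holds (W₀.baseChange ℚ)
  have hpf : ((W₀.baseChange ℚ).conductorNorm ℤ).primeFactors = W₀.Δ.natAbs.primeFactors := by
    rw [← Nat.primeFactors_radical, hrad, Nat.primeFactors_radical]
  rw [hDm]
  refine Finset.prod_eq_one fun p hp ↦ ?_
  obtain ⟨hp, -⟩ := Finset.mem_filter.mp hp
  rw [hpf] at hp
  obtain ⟨hpp, hpd, hne⟩ := Nat.mem_primeFactors.mp hp
  exact le_antisymm (hsq.natFactorization_le_one p) (hpp.factorization_pos_of_dvd hne hpd)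

/-! ## The crux on the slice -/

/-- **The squarefree-discriminant slice of r3″.** `ThinWeightedSzpiro` (at whatever class exponent
`θ` it holds) implies Bombieri–Gubler's generalized Szpiro inequality `max(|Δ|, |c₄|³) ≤ C · N^{6+ε}`
for every integer Weierstrass equation with squarefree discriminant — a statement with no class
condition and no weight: such an equation is a global minimal model, semistable, with `T = 1`, hence
`θ`-thin with `K = 1` for every `θ > 0`. -/
theorem squarefreeSlice_of_thinWeightedSzpiro : ThinWeightedSzpiro →
    ∀ ε : ℝ, 0 < ε → ∃ C : ℝ, ∀ W₀ : WeierstrassCurve ℤ, Squarefree W₀.Δ.natAbs →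
      ((max |W₀.Δ| (|W₀.c₄| ^ 3) : ℤ) : ℝ) ≤
        C * (((W₀.baseChange ℚ).conductorNorm ℤ : ℕ) : ℝ) ^ (6 + ε) := by
  intro h ε hε
  obtain ⟨θ, hθ, hthin⟩ := h
  obtain ⟨C, hC⟩ := hthin ε hε 1
  refine ⟨C, fun W₀ hsq ↦ ?_⟩
  haveI := isElliptic_of_squarefree W₀ hsq
  have hmin := isMinimalAt_of_squarefree W₀ hsq
  have hss : ∀ p : ℕ, p.Prime → p ≠ 2 → ¬ p ^ 2 ∣ (W₀.baseChange ℚ).conductorNorm ℤ :=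
    fun p hp _ ↦ not_sq_dvd_conductorNorm_of_squarefree W₀ hsq hp
  have hT := weight_eq_one_of_squarefree W₀ hsq
  have hN1 : (1 : ℝ) ≤ (((W₀.baseChange ℚ).conductorNorm ℤ : ℕ) : ℝ) := by
    exact_mod_cast conductorNorm_pos_holds (W₀.baseChange ℚ)
  have hthinW : ((∏ p ∈ ((W₀.baseChange ℚ).conductorNorm ℤ).primeFactors with
        ¬ p ^ 2 ∣ (W₀.baseChange ℚ).conductorNorm ℤ,
      ((W₀.baseChange ℚ).minimalDiscriminantNorm ℤ).factorization p : ℕ) : ℝ) ≤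
        1 * (((W₀.baseChange ℚ).conductorNorm ℤ : ℕ) : ℝ) ^ θ := by
    rw [hT, Nat.cast_one, one_mul]
    exact Real.one_le_rpow hN1 hθ.le
  have key := hC W₀ inferInstance hmin hss hthinW
  rwa [hT, Nat.cast_one, mul_one] at key

/-- **r3″ contains Hall's conjecture on squarefree discriminants.** `ThinWeightedSzpiro` implies
`|c₄|³ ≤ C_ε · |Δ|^{6+ε}` for every integer Weierstrass equation with squarefree discriminant, i.e.
the sharp-exponent Hall bound `|x| ≪ |k|^{2+ε}` for the Mordell equations `x³ − y² = 1728 Δ`,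
`Δ` squarefree, at the points `(x, y) = (c₄, c₆)` (`c₄³ − c₆² = 1728 Δ`, `WeierstrassCurve.c_relation`)
— no conductor, minimality, class condition or weight left in the statement (`N ∣ |Δ|`). -/
theorem hallSquarefree_of_thinWeightedSzpiro : Summit.ABC.ABC.Theses.RibetTakahashiSplit.ThinWeightedSzpiro → ∀ ε : ℝ, 0 < ε → ∃ C : ℝ, ∀ W₀ : WeierstrassCurve ℤ, Squarefree W₀.Δ.natAbs → ((|W₀.c₄| ^ 3 : ℤ) : ℝ) ≤ C * ((W₀.Δ.natAbs : ℕ) : ℝ) ^ (6 + ε) := by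
  intro h ε hε
  obtain ⟨C, hC⟩ := squarefreeSlice_of_thinWeightedSzpiro h ε hε
  refine ⟨max C 0, fun W₀ hsq ↦ ?_⟩
  haveI := isElliptic_of_squarefree W₀ hsq
  have hmin := isMinimalAt_of_squarefree W₀ hsq
  have hΔ0 : W₀.Δ ≠ 0 := Δ_ne_zero_of_squarefree W₀ hsq
  have hNle : (((W₀.baseChange ℚ).conductorNorm ℤ : ℕ) : ℝ) ≤ ((W₀.Δ.natAbs : ℕ) : ℝ) := by
    exact_mod_cast Nat.le_of_dvd (Int.natAbs_pos.mpr hΔ0) (conductorNorm_dvd_natAbs_Δ W₀ hmin)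
  have hN0 : (0 : ℝ) ≤ (((W₀.baseChange ℚ).conductorNorm ℤ : ℕ) : ℝ) := by positivity
  have hpow : (((W₀.baseChange ℚ).conductorNorm ℤ : ℕ) : ℝ) ^ (6 + ε) ≤
      ((W₀.Δ.natAbs : ℕ) : ℝ) ^ (6 + ε) :=
    Real.rpow_le_rpow hN0 hNle (by linarith)
  have hc₄ : ((|W₀.c₄| ^ 3 : ℤ) : ℝ) ≤ ((max |W₀.Δ| (|W₀.c₄| ^ 3) : ℤ) : ℝ) := by
    exact_mod_cast le_max_right _ _
  calc ((|W₀.c₄| ^ 3 : ℤ) : ℝ) ≤ ((max |W₀.Δ| (|W₀.c₄| ^ 3) : ℤ) : ℝ) := hc₄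
    _ ≤ C * (((W₀.baseChange ℚ).conductorNorm ℤ : ℕ) : ℝ) ^ (6 + ε) := hC W₀ hsq
    _ ≤ max C 0 * (((W₀.baseChange ℚ).conductorNorm ℤ : ℕ) : ℝ) ^ (6 + ε) :=
      mul_le_mul_of_nonneg_right (le_max_left _ _) (by positivity)
    _ ≤ max C 0 * ((W₀.Δ.natAbs : ℕ) : ℝ) ^ (6 + ε) :=
      mul_le_mul_of_nonneg_left hpow (le_max_right _ _)

end Summit.ABC.ABC.Theorems.ThinWeightedSzpiro
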